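import Summits.HodgeConjecture.HodgeConjecture.Theorems.K2E3SemisimpleOrbitChartUnitary             -- ★ p855365 (this seat): the semisimple orbit chart on `GL_n(E)`
import Summits.HodgeConjecture.HodgeConjecture.Theorems.K2E3CayleySliceCoversNhdsCentral          -- ★ p855283 (K2E1b-p15): (S-d) at a CENTRAL point over `R` (used at `s = 1`)
import Summits.HodgeConjecture.HodgeConjecture.Theorems.K2E3SemisimpleMatrixSurjectiveTransfer   -- ★ (K2E3-p19): `isSemisimple_toLin'_map_evalRingHom`
import Literature.NumberTheory.Automorphic.UnitaryGroupSplitPlace                                  -- ★ `localSplitEquiv` (`U(H)(L⁺_v) ≃ₜ* GL_N(L_w)` at a split place)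
import Literature.NumberTheory.Automorphic.AdelicUnitaryGroupDatum                                 -- ★ `UnitaryGroup.cmDatum`
import HarnessLib

/-!
# K2 · E3 ∕ U12-d, road (S-d) file 3b (SPLIT places) — sub-socket U12-d₂ on the socket's carrier `(cmDatum L N H).Local v` at a place `v` of `L⁺` that splits in `L`:
# transport of the semisimple orbit chart on `GL_N(L_w)` through ★ `localSplitEquiv`, the slice parameter `Y` being read off over `R` by ★ `cayleySliceCoversNhdsCentral` at `s = 1`

HCML Track B «K2-LIT», cell `pub/hodgecm-mathlib`, crux H413 = `stmt-HodgeConjecture-24833` (`--supports … --as helper`), seat `hodgecm-mathlib-K2E3-p12` (g0),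
socket #12 `sig_K2E3NormalizedCharBddNearSemisimple`, sub-socket U12-d₂ `…K2E3EllipticInputs.U12Characters.sig_K2E3CayleySliceConjugatesNhds` (SIGS ED. 3 afcbd7452724).
At a SPLIT place (`w ∣ v`, `c•w ≠ w`) the projection `u ↦ u_w` is `U_N(H)(L⁺_v) ≃ₜ* GL_N(L_w)` (★ `localSplitEquiv`), so the geometric input is Harish-Chandra's
submersion for `GL_N` over the complete field `L_w`: §1 **`exists_nhds_conj_mem_nhds_one`** — for `γ ∈ GL_n(E)` semisimple and any neighbourhood `W` of `1` in `M_n(E)`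
there is an open `U ∋ γ` such that every `g ∈ GL_n(E)` with `↑g ∈ U` has a conjugate `x g x⁻¹` COMMUTING with `γ` and with `γ⁻¹·x g x⁻¹ ∈ W` (★ p855365's chart
`(X, Y′) ↦ c(X) γ c(Y′) c(X)⁻¹`, `x = c(X)⁻¹`).  The slice parameter is then produced OVER `R = L ⊗ L⁺_v` (where the skew clause lives) by ★ `cayleySliceCoversNhdsCentral`
at the central point `1`: `m := s⁻¹ x g x⁻¹` near `1` is `c⁺(Y) = (1+Y)(1−Y)⁻¹` with `Y ∈ V` skew; §2 **`commute_of_commute_cayley`** (`S c⁺(Y) = c⁺(Y) S`, `1 − Y` and `2`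
units ⇒ `S Y = Y S`, any commutative ring) supplies `MAT(s) Y = Y MAT(s)`.  §3 **`cayleySliceConjugatesNhds_of_split`**: the U12-d₂ clauses VERBATIM at a split `v`.
With ★ p855570 (non-split `v`) this pays U12-d₂ at every place (payer file next).  [HarishChandra1999 §18 p. 79; Mok 2015 §1 (`U(N)(F_v) ≅ GL_N(E_w)` at split `v`)]
THEOREMS ONLY; no `sorry`; axioms ⊆ the trio.  HONEST LABEL: HC_CM is proved only modulo the 7 printed citations (2 remaining named inputs: hLiu418 =
stmt-HodgeConjecture-24832, h413 = stmt-HodgeConjecture-24833) until rung 0 closes.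

## References
* [HarishChandra1999AdmissibleDistributions] Harish-Chandra (DeBacker–Sally), *Admissible Invariant Distributions on Reductive p-adic Groups* (1999), §18 p. 79.
* [PlatonovRapinchuk1994] V. Platonov, A. Rapinchuk, *Algebraic Groups and Number Theory* (1994), §5.1, §2.3 (unitary groups at split places).
* [Weyl1939] H. Weyl, *The Classical Groups* (1939), Ch. II §10 (Cayley parametrisation).
-/

set_option autoImplicit false
set_option linter.dupNamespace false

noncomputable section

open Filter Topology Set NumberField IsDedekindDomain
open scoped Matrix MatrixGroups Matrix.Norms.Operator
open Literature.Analysis.Calculus Literature.LinearAlgebra.Matrix Literature.NumberTheory.Automorphic Literature.NumberTheory.Automorphic.UnitaryGroup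
open Summit.HodgeConjecture.HodgeConjecture.Cruxes.H413.K2E3SemisimpleOrbitChartUnitary
open Summit.HodgeConjecture.HodgeConjecture.Cruxes.H413.K2E3CayleySliceCoversNhdsCentral
open Summit.HodgeConjecture.HodgeConjecture.Cruxes.H413.K2E3SemisimpleMatrixSurjectiveTransfer

namespace Summit.HodgeConjecture.HodgeConjecture.Cruxes.H413.K2E3CayleySliceConjugatesNhdsSplit

/-! ## §1 Field model on `GL_n(E)`: conjugating into the commutant of `γ`, arbitrarily close to `γ` -/

section Field

variable {E : Type*} [NontriviallyNormedField E] [CompleteSpace E] [CharZero E] {n : Type*} [Fintype n] [DecidableEq n]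

/-- **Near a semisimple `γ ∈ GL_n(E)`, every `g` is conjugate to an element `x g x⁻¹` commuting with `γ` and with `γ⁻¹ · x g x⁻¹` in any prescribed
neighbourhood `W` of `1`.**  (★ `exists_openPartialHomeomorph_cayleyConj_of_isSemisimple`: `g = c(X) γ c(Y′) c(X)⁻¹` with `Y′ ∈ C(γ)`; `x := c(X)⁻¹`, so
`x g x⁻¹ = γ c(Y′)` and `γ⁻¹ x g x⁻¹ = c(Y′) → 1` as `g → γ`.)
[cite: HarishChandra1999AdmissibleDistributions, §18 p. 79] [cite: Weyl1939, Ch. II §10] -/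
theorem exists_nhds_conj_mem_nhds_one (γ : GL n E) (hγ : Module.End.IsSemisimple (Matrix.toLin' (γ : Matrix n n E)))
    (W : Set (Matrix n n E)) (hW : W ∈ 𝓝 (1 : Matrix n n E)) :
    ∃ U : Set (Matrix n n E), IsOpen U ∧ (γ : Matrix n n E) ∈ U ∧
      ∀ g : GL n E, (g : Matrix n n E) ∈ U → ∃ x : GL n E,
        ((γ⁻¹ * (x * g * x⁻¹) : GL n E) : Matrix n n E) ∈ W ∧
        (γ : Matrix n n E) * ((x * g * x⁻¹ : GL n E) : Matrix n n E) = ((x * g * x⁻¹ : GL n E) : Matrix n n E) * (γ : Matrix n n E) := by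
  haveI : @CompleteSpace (Matrix n n E) PseudoMetricSpace.toUniformSpace := FiniteDimensional.complete E (Matrix n n E)
  set ad : Module.End E (Matrix n n E) :=
    LinearMap.mulLeft E (γ : Matrix n n E) - LinearMap.mulRight E (γ : Matrix n n E) with had
  obtain ⟨e, h0, -, he, hunits⟩ := exists_openPartialHomeomorph_cayleyConj_of_isSemisimple γ hγ
  -- `p ↦ c(p.2)` is continuous at `0` with value `1`, so `{p | c(↑p.2) ∈ W}` is a neighbourhood of `0`
  have hcay : ContinuousAt (cayley : Matrix n n E → Matrix n n E) 0 :=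
    (hasStrictFDerivAt_cayley_zero (𝕜 := E) (R := Matrix n n E)).continuousAt
  have h2c : Continuous fun p : ↥(LinearMap.range ad) × ↥(LinearMap.ker ad) => (p.2 : Matrix n n E) :=
    continuous_subtype_val.comp continuous_snd
  have h20 : (fun p : ↥(LinearMap.range ad) × ↥(LinearMap.ker ad) => (p.2 : Matrix n n E)) 0 = 0 := rfl
  have hf : ContinuousAt (fun p : ↥(LinearMap.range ad) × ↥(LinearMap.ker ad) => cayley (p.2 : Matrix n n E)) 0 := by
    have h := hcay
    rw [← h20] at h
    exact ContinuousAt.comp (g := (cayley : Matrix n n E → Matrix n n E)) h h2c.continuousAt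
  have hPW : (fun p : ↥(LinearMap.range ad) × ↥(LinearMap.ker ad) => cayley (p.2 : Matrix n n E)) ⁻¹' W ∈
      𝓝 (0 : ↥(LinearMap.range ad) × ↥(LinearMap.ker ad)) := by
    refine hf.preimage_mem_nhds ?_
    simp only [Prod.snd_zero, ZeroMemClass.coe_zero, cayley_zero]
    exact hW
  obtain ⟨P, hPsub, hPo, h0P⟩ := mem_nhds_iff.1 hPW
  refine ⟨e '' (e.source ∩ P), e.isOpen_image_of_subset_source (e.open_source.inter hPo) Set.inter_subset_left, ?_, ?_⟩
  · refine ⟨0, ⟨h0, h0P⟩, ?_⟩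
    rw [he]
    simp only [Prod.fst_zero, Prod.snd_zero, ZeroMemClass.coe_zero, cayley_zero, Ring.inverse_one, mul_one, one_mul]
  · rintro g ⟨p, ⟨hps, hpP⟩, hpg⟩
    obtain ⟨hxp, hxm, hyp, hym⟩ := hunits p hps
    set X : Matrix n n E := (p.1 : Matrix n n E) with hXdef
    set Y' : Matrix n n E := (p.2 : Matrix n n E) with hY'def
    -- the conjugator `x = c(X)⁻¹`
    obtain ⟨u, hu⟩ : ∃ u : GL n E, (u : Matrix n n E) = cayley X := ⟨(isUnit_cayley hxp hxm).unit, rfl⟩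
    have hcinv : Ring.inverse (cayley X) = cayley (-X) := ringInverse_cayley hxp hxm
    have hu' : ((u⁻¹ : GL n E) : Matrix n n E) = cayley (-X) := by
      rw [Matrix.coe_units_inv, hu, Matrix.nonsing_inv_eq_ringInverse, hcinv]
    have hconj : ((u⁻¹ * g * u⁻¹⁻¹ : GL n E) : Matrix n n E) = (γ : Matrix n n E) * cayley Y' := by
      rw [Units.val_mul, Units.val_mul, inv_inv, hu', hu, ← hpg, he p, hcinv]
      calc cayley (-X) * (cayley X * ((γ : Matrix n n E) * cayley Y') * cayley (-X)) * cayley X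
          = (cayley (-X) * cayley X) * ((γ : Matrix n n E) * cayley Y') * (cayley (-X) * cayley X) := by
            simp only [Matrix.mul_assoc]
        _ = (γ : Matrix n n E) * cayley Y' := by
            rw [cayley_neg_mul_cayley hxp hxm, Matrix.one_mul, Matrix.mul_one]
    -- `γ` commutes with `c(Y′)` (`Y′ ∈ C(γ)`; `(1 + Y′)⁻¹` through the unit `1 + Y′`)
    have hk : (γ : Matrix n n E) * Y' = Y' * (γ : Matrix n n E) := by
      have hk := p.2.2
      rw [LinearMap.mem_ker, LinearMap.sub_apply, LinearMap.mulLeft_apply, LinearMap.mulRight_apply, sub_eq_zero] at hk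
      exact hk
    have hcomm : Commute (γ : Matrix n n E) (cayley Y') := by
      obtain ⟨up, hup⟩ := hyp
      have hc1 : Commute (γ : Matrix n n E) Y' := hk
      have hcp : Commute (γ : Matrix n n E) (up : Matrix n n E) := by
        rw [hup]; exact (Commute.one_right _).add_right hc1
      rw [cayley_def, ← hup, Ring.inverse_unit]
      exact ((Commute.one_right _).sub_right hc1).mul_right hcp.units_inv_right
    refine ⟨u⁻¹, ?_, ?_⟩
    · rw [Units.val_mul, hconj, ← Matrix.mul_assoc, Units.inv_mul, Matrix.one_mul]
      exact hPsub hpP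
    · rw [hconj, Matrix.mul_assoc, ← hcomm.eq]

end Field

/-! ## §2 Commuting with `c⁺(Y) = (1+Y)(1−Y)⁻¹` forces commuting with `Y` (when `1 − Y` and `2` are units) -/

section Algebra

variable {R : Type*} [CommRing R] {n : Type*} [Fintype n] [DecidableEq n]

/-- If `S` commutes with `(1 + Y)(1 − Y)⁻¹`, `1 − Y` is invertible and `2` is a unit of `R`, then `S` commutes with `Y`:
`(1−Y) S (1+Y) = (1+Y) S (1−Y)` expands to `2(SY − YS) = 0`. [cite: Weyl1939, Ch. II §10] -/
theorem commute_of_commute_cayley (S Y : Matrix n n R) (h2 : IsUnit (2 : R)) (h1 : IsUnit (1 - Y))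
    (hc : S * ((1 + Y) * (1 - Y)⁻¹) = ((1 + Y) * (1 - Y)⁻¹) * S) : S * Y = Y * S := by
  have h1d : IsUnit (1 - Y).det := (Matrix.isUnit_iff_isUnit_det _).1 h1
  -- (1) clear the inverse on the right: `S (1+Y) = (1+Y)(1−Y)⁻¹ S (1−Y)`
  have hA : S * (1 + Y) = (1 + Y) * (1 - Y)⁻¹ * S * (1 - Y) := by
    have h := congrArg (fun M => M * (1 - Y)) hc
    simp only [Matrix.mul_assoc] at h
    rw [Matrix.nonsing_inv_mul _ h1d, Matrix.mul_one] at h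
    simpa only [Matrix.mul_assoc] using h
  -- (2) clear it on the left: `(1−Y) S (1+Y) = (1+Y) S (1−Y)` (`1−Y` and `1+Y` commute)
  have hpm : (1 - Y) * (1 + Y) = (1 + Y) * (1 - Y) := by noncomm_ring
  have hB : (1 - Y) * S * (1 + Y) = (1 + Y) * S * (1 - Y) := by
    rw [Matrix.mul_assoc, hA, ← Matrix.mul_assoc, ← Matrix.mul_assoc, ← Matrix.mul_assoc, hpm, Matrix.mul_nonsing_inv_cancel_right _ _ h1d]
  -- (3) expand: `2 • (SY − YS) = 0`
  have e1 : (1 - Y) * S * (1 + Y) = S + S * Y - Y * S - Y * S * Y := by noncomm_ring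
  have e2 : (1 + Y) * S * (1 - Y) = S - S * Y + Y * S - Y * S * Y := by noncomm_ring
  rw [e1, e2] at hB
  have e3 : (2 : ℤ) • (S * Y - Y * S) = 0 := by
    calc (2 : ℤ) • (S * Y - Y * S) = (S + S * Y - Y * S - Y * S * Y) - (S - S * Y + Y * S - Y * S * Y) := by abel
      _ = 0 := sub_eq_zero.2 hB
  have e4 : (2 : R) • (S * Y - Y * S) = (2 : R) • (0 : Matrix n n R) := by
    rw [smul_zero, ← e3, ← Int.cast_smul_eq_zsmul R (2 : ℤ) (S * Y - Y * S), Int.cast_ofNat]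
  exact sub_eq_zero.1 ((h2.smul_left_cancel).1 e4)

end Algebra


/-! ## §3 Transport to `U_N(H)(L⁺_v)` at a SPLIT place -/

section Split

variable (L : Type) [Field L] [NumberField L] [IsCMField L] (N : ℕ) (H : Matrix (Fin N) (Fin N) L)
  (v : HeightOneSpectrum (𝓞 ↥(maximalRealSubfield L)))

/-- **(S-d) at a SPLIT place, in the subgroup model `U_N(H)(L⁺_v) ≤ GL_N(L ⊗ L⁺_v)`.**  `v` a finite place of `L⁺`, `w ∣ v` with `c•w ≠ w`; `H` hermitian with
`det H ≠ 0`; `s ∈ U_N(H)(L⁺_v)` with semisimple matrix; `V` a neighbourhood of `0` in `M_N(L ⊗ L⁺_v)`.  Then there is an open `U ∋ s` such that every `g ∈ U` is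
conjugate, by some `x ∈ U_N(H)(L⁺_v)`, to `s·(1+Y)(1−Y)⁻¹` with `Y ∈ V` skew, commuting with `s`, `1 ± Y` units (the U12-d₂ clauses).
Route: `x` from §1 on `GL_N(L_w)` through ★ `localSplitEquiv`; `Y` over `R` from ★ `exists_open_cayley_slice_central` at the central point `1` applied to
`m = s⁻¹·x g x⁻¹`; `MAT(s) Y = Y MAT(s)` by §2. [cite: HarishChandra1999AdmissibleDistributions, §18 p. 79] [cite: PlatonovRapinchuk1994, §5.1] -/
theorem cayleySliceConjugatesNhds_of_split_subgroup (hH : (H.map (cmConjRingHom L))ᵀ = H) (hHd : H.det ≠ 0)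
    (w : UnitaryGroup.PlacesOver L v) (hw : IsCMField.complexConj L • w.1 ≠ w.1)
    (s : ↥(UnitaryGroup.«local» L (IsCMField.complexConj L) N H v)) (hs : Module.End.IsSemisimple (Matrix.toLin' ((s.val : GL (Fin N) (UnitaryGroup.LocalRing L v)) : Matrix (Fin N) (Fin N) (UnitaryGroup.LocalRing L v))))
    (V : Set (Matrix (Fin N) (Fin N) (UnitaryGroup.LocalRing L v))) (hV : V ∈ 𝓝 (0 : Matrix (Fin N) (Fin N) (UnitaryGroup.LocalRing L v))) :
    ∃ U : Set ↥(UnitaryGroup.«local» L (IsCMField.complexConj L) N H v), IsOpen U ∧ s ∈ U ∧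
      ∀ g ∈ U, ∃ x : ↥(UnitaryGroup.«local» L (IsCMField.complexConj L) N H v), ∃ Y ∈ V,
        (Y.map (UnitaryGroup.conjLocal L (IsCMField.complexConj L) v))ᵀ * ((UnitaryGroup.adelicForm L N H).map (UnitaryGroup.adeleToLocal L v)) = -(((UnitaryGroup.adelicForm L N H).map (UnitaryGroup.adeleToLocal L v)) * Y) ∧
        ((s.val : GL (Fin N) (UnitaryGroup.LocalRing L v)) : Matrix (Fin N) (Fin N) (UnitaryGroup.LocalRing L v)) * Y = Y * ((s.val : GL (Fin N) (UnitaryGroup.LocalRing L v)) : Matrix (Fin N) (Fin N) (UnitaryGroup.LocalRing L v)) ∧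
        IsUnit (1 - Y) ∧ IsUnit (1 + Y) ∧
        (((x * g * x⁻¹).val : GL (Fin N) (UnitaryGroup.LocalRing L v)) : Matrix (Fin N) (Fin N) (UnitaryGroup.LocalRing L v)) = ((s.val : GL (Fin N) (UnitaryGroup.LocalRing L v)) : Matrix (Fin N) (Fin N) (UnitaryGroup.LocalRing L v)) * ((1 + Y) * (1 - Y)⁻¹) := by
  classical
  -- `L_w` as a complete non-trivially normed field of characteristic zero; `M_N(L_w)` a complete normed ring
  letI : NontriviallyNormedField (w.1.adicCompletion L) := Valued.toNontriviallyNormedField (w.1.adicCompletion L) (WithZero (Multiplicative ℤ))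
  haveI : CharZero (w.1.adicCompletion L) := charZero_of_injective_algebraMap (algebraMap L (w.1.adicCompletion L)).injective
  haveI : HasSummableGeomSeries (Matrix (Fin N) (Fin N) (w.1.adicCompletion L)) :=
    @instHasSummableGeomSeriesOfCompleteSpace (Matrix (Fin N) (Fin N) (w.1.adicCompletion L)) _ (FiniteDimensional.complete (w.1.adicCompletion L) (Matrix (Fin N) (Fin N) (w.1.adicCompletion L)))
  have hc : IsCMField.complexConj L ≠ 1 := IsCMField.complexConj_ne_one L
  have hJ : (H.map (IsCMField.complexConj L))ᵀ = H := hH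
  have hJw : IsUnit (UnitaryGroup.placeForm H w.1) :=
    UnitaryGroup.isUnit_placeForm H ((Matrix.isUnit_iff_isUnit_det H).2 (isUnit_iff_ne_zero.2 hHd)) w.1
  -- the split model `e : U_N(H)(L⁺_v) ≃ₜ* GL_N(L_w)`, `e g = g_w`
  set e := UnitaryGroup.localSplitEquiv (IsCMField.complexConj L) H hc hJ w hw hJw with he
  have hemat : ∀ g : ↥(UnitaryGroup.«local» L (IsCMField.complexConj L) N H v), ((e g : GL (Fin N) (w.1.adicCompletion L)) : Matrix (Fin N) (Fin N) (w.1.adicCompletion L)) = ((g.val : GL (Fin N) (UnitaryGroup.LocalRing L v)) : Matrix (Fin N) (Fin N) (UnitaryGroup.LocalRing L v)).map (Pi.evalRingHom (fun w' : UnitaryGroup.PlacesOver L v => w'.1.adicCompletion L) w) := by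
    intro g
    rw [he, UnitaryGroup.localSplitEquiv, ContinuousMulEquiv.trans_apply, UnitaryGroup.localPiSplitEquiv_apply,
      UnitaryGroup.coe_localPiEquiv_symm_apply, GLn.coe_piEquiv_apply]
  -- (1) the central covering at `1` over `R` (★ K2E1b-p15, generic form)
  have h1 : ((((1 : ↥(UnitaryGroup.«local» L (IsCMField.complexConj L) N H v)) : GL (Fin N) (UnitaryGroup.LocalRing L v)) : Matrix (Fin N) (Fin N) (UnitaryGroup.LocalRing L v))) = ((1 : (UnitaryGroup.LocalRing L v)ˣ) : UnitaryGroup.LocalRing L v) • (1 : Matrix (Fin N) (Fin N) (UnitaryGroup.LocalRing L v)) := by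
    rw [OneMemClass.coe_one, Units.val_one, Units.val_one, one_smul]
  obtain ⟨U₁, hU₁o, h1U₁, hU₁⟩ := exists_open_cayley_slice_central (isOpen_setOf_isUnit_localRing L v)
    (fun x hx => continuousAt_ringInverse_localRing L v hx) (isUnit_two_localRing L v) (UnitaryGroup.conjLocal L (IsCMField.complexConj L) v) ((UnitaryGroup.adelicForm L N H).map (UnitaryGroup.adeleToLocal L v))
    (UnitaryGroup.«local» L (IsCMField.complexConj L) N H v) (fun g => (mem_unitaryGroupOfForm_iff).1 g.2) 1 1 h1 V hV
  -- (2) `W := val(e(U₁))` is a neighbourhood of `1` in `M_N(L_w)` (`e` a homeomorphism, `val : GL → M` an open map over the complete field `L_w`)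
  have hopen : IsOpen ((e : ↥(UnitaryGroup.«local» L (IsCMField.complexConj L) N H v) → GL (Fin N) (w.1.adicCompletion L)) '' U₁) := e.toHomeomorph.isOpenMap U₁ hU₁o
  have hW : (Units.val '' ((e : ↥(UnitaryGroup.«local» L (IsCMField.complexConj L) N H v) → GL (Fin N) (w.1.adicCompletion L)) '' U₁)) ∈ 𝓝 (1 : Matrix (Fin N) (Fin N) (w.1.adicCompletion L)) := by
    refine (Units.isOpenMap_val _ hopen).mem_nhds ?_
    exact ⟨1, ⟨1, h1U₁, map_one e⟩, Units.val_one⟩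
  -- (3) semisimplicity of `s_w` (★ K2E3-p19) and §1 on `GL_N(L_w)`
  have hss : Module.End.IsSemisimple (Matrix.toLin' ((e s : GL (Fin N) (w.1.adicCompletion L)) : Matrix (Fin N) (Fin N) (w.1.adicCompletion L))) := by
    rw [hemat]
    exact isSemisimple_toLin'_map_evalRingHom _ hs w
  obtain ⟨U', hU'o, hsU', hmain⟩ := exists_nhds_conj_mem_nhds_one (e s : GL (Fin N) (w.1.adicCompletion L)) hss _ hW
  -- (4) the open set on `G`: preimage of `U'` under `g ↦ MAT(g)_w`
  have hcont : Continuous fun g : ↥(UnitaryGroup.«local» L (IsCMField.complexConj L) N H v) => ((g.val : GL (Fin N) (UnitaryGroup.LocalRing L v)) : Matrix (Fin N) (Fin N) (UnitaryGroup.LocalRing L v)).map (Pi.evalRingHom (fun w' : UnitaryGroup.PlacesOver L v => w'.1.adicCompletion L) w) :=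
    (Units.continuous_val.comp continuous_subtype_val).matrix_map (continuous_apply w)
  refine ⟨(fun g : ↥(UnitaryGroup.«local» L (IsCMField.complexConj L) N H v) => ((g.val : GL (Fin N) (UnitaryGroup.LocalRing L v)) : Matrix (Fin N) (Fin N) (UnitaryGroup.LocalRing L v)).map (Pi.evalRingHom (fun w' : UnitaryGroup.PlacesOver L v => w'.1.adicCompletion L) w)) ⁻¹' U', hU'o.preimage hcont, ?_, fun g hg => ?_⟩
  · rw [Set.mem_preimage, ← hemat]; exact hsU'
  · obtain ⟨x', hmem, hcomm'⟩ := hmain (e g) (by rw [hemat]; exact hg)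
    obtain ⟨u₁, ⟨m, hmU₁, hmu⟩, hu₁⟩ := hmem
    have hem : e m = (e s)⁻¹ * (x' * e g * x'⁻¹) := by rw [hmu]; exact Units.ext hu₁
    obtain ⟨x, hx⟩ : ∃ x : ↥(UnitaryGroup.«local» L (IsCMField.complexConj L) N H v), e x = x' := ⟨e.symm x', e.apply_symm_apply x'⟩
    -- `s m = x g x⁻¹` and `s m = m s` in `G` (through the group isomorphism `e`)
    have hkey : s * m = x * g * x⁻¹ := by
      apply e.injective
      rw [map_mul, hem, mul_inv_cancel_left, map_mul, map_mul, map_inv, hx]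
    have hsm : s * m = m * s := by
      have h3 : e s * e (x * g * x⁻¹) = e (x * g * x⁻¹) * e s := by
        refine Units.ext ?_
        rw [Units.val_mul, Units.val_mul, map_mul, map_mul, map_inv, hx]
        exact hcomm'
      have h4 : s * (x * g * x⁻¹) = (x * g * x⁻¹) * s :=
        e.injective (by rw [map_mul e s (x * g * x⁻¹), map_mul e (x * g * x⁻¹) s]; exact h3)
      rw [← hkey] at h4
      exact mul_left_cancel (h4.trans (mul_assoc s m s))
    -- (5) the slice parameter over `R`
    obtain ⟨Y, hYV, hskew, -, hY1, hY2, hmY⟩ := hU₁ m hmU₁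
    rw [OneMemClass.coe_one, Units.val_one, Matrix.one_mul] at hmY
    have hSM : ((s.val : GL (Fin N) (UnitaryGroup.LocalRing L v)) : Matrix (Fin N) (Fin N) (UnitaryGroup.LocalRing L v)) * ((m.val : GL (Fin N) (UnitaryGroup.LocalRing L v)) : Matrix (Fin N) (Fin N) (UnitaryGroup.LocalRing L v)) = ((m.val : GL (Fin N) (UnitaryGroup.LocalRing L v)) : Matrix (Fin N) (Fin N) (UnitaryGroup.LocalRing L v)) * ((s.val : GL (Fin N) (UnitaryGroup.LocalRing L v)) : Matrix (Fin N) (Fin N) (UnitaryGroup.LocalRing L v)) := by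
      have h := congrArg (fun t : ↥(UnitaryGroup.«local» L (IsCMField.complexConj L) N H v) => ((t : GL (Fin N) (UnitaryGroup.LocalRing L v)) : Matrix (Fin N) (Fin N) (UnitaryGroup.LocalRing L v))) hsm
      simpa only [Subgroup.coe_mul, Units.val_mul] using h
    have hSY : ((s.val : GL (Fin N) (UnitaryGroup.LocalRing L v)) : Matrix (Fin N) (Fin N) (UnitaryGroup.LocalRing L v)) * Y = Y * ((s.val : GL (Fin N) (UnitaryGroup.LocalRing L v)) : Matrix (Fin N) (Fin N) (UnitaryGroup.LocalRing L v)) :=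
      commute_of_commute_cayley _ Y (isUnit_two_localRing L v) hY1 (by rw [← hmY]; exact hSM)
    refine ⟨x, Y, hYV, hskew, hSY, hY1, hY2, ?_⟩
    rw [← hkey, Subgroup.coe_mul, Units.val_mul, hmY]

/-- **(S-d) at a SPLIT place, on the socket's carrier `(cmDatum L N H).Local v`** (= the subgroup model, definitionally): the U12-d₂ clauses VERBATIM.
[cite: HarishChandra1999AdmissibleDistributions, §18 p. 79] [cite: PlatonovRapinchuk1994, §5.1] -/
theorem cayleySliceConjugatesNhds_of_split (hH : (H.map (cmConjRingHom L))ᵀ = H) (hHd : H.det ≠ 0)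
    (w : UnitaryGroup.PlacesOver L v) (hw : IsCMField.complexConj L • w.1 ≠ w.1)
    (s : (UnitaryGroup.cmDatum L N H).Local v) (hs : Module.End.IsSemisimple (Matrix.toLin' ((s.val : GL (Fin N) (UnitaryGroup.LocalRing L v)).val : Matrix (Fin N) (Fin N) (UnitaryGroup.LocalRing L v))))
    (V : Set (Matrix (Fin N) (Fin N) (UnitaryGroup.LocalRing L v))) (hV : V ∈ 𝓝 (0 : Matrix (Fin N) (Fin N) (UnitaryGroup.LocalRing L v))) :
    ∃ U : Set ((UnitaryGroup.cmDatum L N H).Local v), IsOpen U ∧ s ∈ U ∧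
      ∀ g ∈ U, ∃ x : (UnitaryGroup.cmDatum L N H).Local v, ∃ Y ∈ V,
        (Y.map (UnitaryGroup.conjLocal L (IsCMField.complexConj L) v))ᵀ * ((UnitaryGroup.adelicForm L N H).map (UnitaryGroup.adeleToLocal L v)) = -(((UnitaryGroup.adelicForm L N H).map (UnitaryGroup.adeleToLocal L v)) * Y) ∧
        ((s.val : GL (Fin N) (UnitaryGroup.LocalRing L v)).val : Matrix (Fin N) (Fin N) (UnitaryGroup.LocalRing L v)) * Y = Y * ((s.val : GL (Fin N) (UnitaryGroup.LocalRing L v)).val : Matrix (Fin N) (Fin N) (UnitaryGroup.LocalRing L v)) ∧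
        IsUnit (1 - Y) ∧ IsUnit (1 + Y) ∧
        (((x * g * x⁻¹).val : GL (Fin N) (UnitaryGroup.LocalRing L v)).val : Matrix (Fin N) (Fin N) (UnitaryGroup.LocalRing L v)) = ((s.val : GL (Fin N) (UnitaryGroup.LocalRing L v)).val : Matrix (Fin N) (Fin N) (UnitaryGroup.LocalRing L v)) * ((1 + Y) * (1 - Y)⁻¹) :=
  cayleySliceConjugatesNhds_of_split_subgroup L N H v hH hHd w hw s hs V hV

end Split

end Summit.HodgeConjecture.HodgeConjecture.Cruxes.H413.K2E3CayleySliceConjugatesNhdsSplit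

end
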